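import Mathlib.RingTheory.Localization.Ideal
import Mathlib.RingTheory.Localization.AtPrime.Basic
import Mathlib.RingTheory.Localization.Away.Basic
import Mathlib.RingTheory.Noetherian.Basic
import HarnessLib

/-!
# Crux `FrobeniusLadder.FRationalResolution` (stmt-ResolutionOfSingularities-15317), line `redirect`,
# stub `stub_diagonalizableQuotientResolution` — spreading an inclusion of ideals from `C_𝔔` to a basic open

Brick T3-d of the repair census: the hypothesis `𝔔 C_g ≤ 𝔭 C_g` of `…CentreDescent.exists_descended_centre`
("over `D(g)` the fibre of `𝔭` is the reduced point `𝔔`") from UNRAMIFIEDNESS AT `𝔔`, i.e. from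
`𝔭 C_𝔔 = 𝔪_{C_𝔔}` (Mathlib `Algebra.isUnramifiedAt_iff_map_eq`; automatic for an étale chart):

* `exists_away_map_le_of_map_atPrime_le` — for a finitely generated ideal `J₁` and any ideal `J₂` of `C`,
  `J₁ C_𝔔 ≤ J₂ C_𝔔` implies `J₁ C_g ≤ J₂ C_g` for some `g ∉ 𝔔` (clear the finitely many denominators);
* `exists_away_fibre_reduced` — hence, for Noetherian `C`, `𝔭 C_𝔔 = 𝔪_{C_𝔔}` gives `g ∉ 𝔔` with
  `𝔔 C_g ≤ 𝔭 C_g` (so `𝔔` is the only point of `D(g)` over `𝔭` and the fibre there is reduced).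

Honest label: plumbing (no stub closed). No definitions, no named facts, no sorry.
[folklore; cite: StacksProject, Tag 00UW]
-/

noncomputable section

-- single-problem summit: the doubled namespace component is forced
set_option linter.dupNamespace false

namespace Summit.ResolutionOfSingularities.ResolutionOfSingularities.Theorems.FRationalResolution.FibreReduced

universe u

variable {B C : Type u} [CommRing B] [CommRing C]

/-- **An inclusion of ideals at the local ring `C_𝔔` spreads to a basic open `D(g) ∋ 𝔔`** when the smaller ideal is
finitely generated: `J₁ C_𝔔 ≤ J₂ C_𝔔 ⇒ J₁ C_g ≤ J₂ C_g` for some `g ∉ 𝔔` (each generator `x` of `J₁` has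
`c x ∈ J₂` for some `c ∉ 𝔔`; take `g = ∏ c`). [folklore] -/
theorem exists_away_map_le_of_map_atPrime_le (𝔔 : Ideal C) [h𝔔 : 𝔔.IsPrime] (J₁ J₂ : Ideal C)
    (hfg : J₁.FG)
    (hle : J₁.map (algebraMap C (Localization.AtPrime 𝔔)) ≤
      J₂.map (algebraMap C (Localization.AtPrime 𝔔))) :
    ∃ g : C, g ∉ 𝔔 ∧
      J₁.map (algebraMap C (Localization.Away g)) ≤ J₂.map (algebraMap C (Localization.Away g)) := by
  classical
  obtain ⟨s, hs⟩ := hfg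
  -- each generator is multiplied into `J₂` by an element outside `𝔔`
  have hgen : ∀ x ∈ s, ∃ c : C, c ∉ 𝔔 ∧ c * x ∈ J₂ := by
    intro x hx
    have hx1 : x ∈ J₁ := hs ▸ Ideal.subset_span hx
    have hx2 : algebraMap C (Localization.AtPrime 𝔔) x ∈
        J₂.map (algebraMap C (Localization.AtPrime 𝔔)) := hle (Ideal.mem_map_of_mem _ hx1)
    obtain ⟨⟨⟨a, ha⟩, t⟩, hat⟩ :=
      (IsLocalization.mem_map_algebraMap_iff 𝔔.primeCompl (Localization.AtPrime 𝔔)).mp hx2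
    -- `x * t = a` up to a factor outside `𝔔`
    have hat' : algebraMap C (Localization.AtPrime 𝔔) (x * t) =
        algebraMap C (Localization.AtPrime 𝔔) a := by
      rw [map_mul]; exact hat
    obtain ⟨u, hu⟩ := (IsLocalization.eq_iff_exists 𝔔.primeCompl (Localization.AtPrime 𝔔)).mp hat'
    refine ⟨u * t, ?_, ?_⟩
    · intro hmem
      rcases h𝔔.mem_or_mem hmem with h | h
      · exact u.2 h
      · exact t.2 h
    · have : (u : C) * (t : C) * x = u * a := by rw [← hu]; ring
      rw [this]
      exact J₂.mul_mem_left _ ha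
  choose! c hc𝔔 hcJ using hgen
  refine ⟨∏ x ∈ s, c x, ?_, ?_⟩
  · -- `g ∉ 𝔔` (prime)
    intro hmem
    obtain ⟨x, hx, hcx⟩ := (h𝔔.prod_mem_iff (s := s) (x := c)).mp hmem
    exact hc𝔔 x hx hcx
  · -- `J₁ C_g ≤ J₂ C_g`
    set L := Localization.Away (∏ x ∈ s, c x) with hL
    rw [← hs, Ideal.map_span, Ideal.span_le]
    rintro _ ⟨x, hx, rfl⟩
    have hunitg : IsUnit (algebraMap C L (∏ y ∈ s, c y)) :=
      IsLocalization.Away.algebraMap_isUnit (∏ y ∈ s, c y)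
    have hdvd : c x ∣ ∏ y ∈ s, c y := Finset.dvd_prod_of_mem c hx
    have hunit : IsUnit (algebraMap C L (c x)) := by
      obtain ⟨r, hr⟩ := hdvd
      have hmul : algebraMap C L (∏ y ∈ s, c y) = algebraMap C L (c x) * algebraMap C L r := by
        have := congrArg (algebraMap C L) hr
        rwa [map_mul] at this
      rw [hmul] at hunitg
      exact isUnit_of_mul_isUnit_left hunitg
    obtain ⟨v, hv⟩ := hunit
    have hx' : algebraMap C L x = ↑v⁻¹ * algebraMap C L (c x * x) := by
      rw [map_mul, ← hv, ← mul_assoc, Units.inv_mul, one_mul]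
    rw [SetLike.mem_coe, hx']
    exact Ideal.mul_mem_left _ _ (Ideal.mem_map_of_mem _ (hcJ x hx))

/-- **Unramified at `𝔔` ⇒ over some `D(g) ∋ 𝔔` the fibre of `𝔭` is the reduced point `𝔔`.** For Noetherian `C`,
an algebra `B → C`, and primes `𝔭 ⊆ B`, `𝔔 ⊆ C` with `𝔭 C_𝔔 = 𝔪_{C_𝔔}` (Mathlib `Algebra.isUnramifiedAt_iff_map_eq`),
there is `g ∉ 𝔔` with `𝔔 C_g ≤ 𝔭 C_g` — the hypothesis `hunr` of `…CentreDescent.exists_descended_centre`.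
[cite: StacksProject, Tag 00UW] -/
theorem exists_away_fibre_reduced [Algebra B C] [IsNoetherianRing C] (𝔭 : Ideal B) (𝔔 : Ideal C)
    [h𝔔 : 𝔔.IsPrime]
    (hunr : 𝔭.map (algebraMap B (Localization.AtPrime 𝔔)) =
      IsLocalRing.maximalIdeal (Localization.AtPrime 𝔔)) :
    ∃ g : C, g ∉ 𝔔 ∧ 𝔔.map (algebraMap C (Localization.Away g)) ≤
      𝔭.map ((algebraMap C (Localization.Away g)).comp (algebraMap B C)) := by
  have hle : 𝔔.map (algebraMap C (Localization.AtPrime 𝔔)) ≤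
      (𝔭.map (algebraMap B C)).map (algebraMap C (Localization.AtPrime 𝔔)) := by
    rw [Localization.AtPrime.map_eq_maximalIdeal, ← hunr, Ideal.map_map,
      ← IsScalarTower.algebraMap_eq]
  obtain ⟨g, hg, hg'⟩ := exists_away_map_le_of_map_atPrime_le 𝔔 𝔔 (𝔭.map (algebraMap B C))
    (IsNoetherian.noetherian 𝔔) hle
  refine ⟨g, hg, ?_⟩
  rw [← Ideal.map_map]
  exact hg'

end Summit.ResolutionOfSingularities.ResolutionOfSingularities.Theorems.FRationalResolution.FibreReduced

end
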